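import Summits.CriticalPhenomena.SAWScalingLimit.Theorems.SAWWeldingIdentificationWeldingLawOfLimitLattice

/-!
# The lattice welding law is sandwiched by the conjunct (crux `WeldingLawOfLimit`, stmt-4502)

Route `SAWWeldingIdentification` of `CriticalPhenomena/SAWScalingLimit`, crux (W)
`WeldingLawOfLimit` (stmt-CriticalPhenomena-4502), line `registered`. The companion file
`…WeldingLawOfLimitLattice.lean` proves that the LATTICE form of the held stub 2a — chord proxies
`cₙ ω` of the critical SAW at mesh `δₙ`, eventually almost surely simple chords of
`(Ω; a, b) = Q.chord 0 2` and close to the walk in probability, whose canonical-welding marginals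
converge to those of chordal SLE_{8/3} — implies stub 2a (`approxWeldingLaw_of_latticeWeldingLaw`)
and, with the shared simplicity crux stmt-4982, the crux. This file records the converse
bookkeeping, so that the lattice form is seen to be an HONEST intermediate (no strength added
beyond purely geometric lattice inputs):

* `latticeWeldingLaw_of_sawScalingLimit`: the conjunct `SAWScalingLimit` together with the bare
  EXISTENCE of chord proxies (eventually a.s. simple chords, close in probability — no welding in
  it) implies the lattice welding law: along `δₙ → 0⁺` the walks converge in law to SLE_{8/3}, hence
  so do the proxies (converging together, `tendsto_integral_comp_of_tendsto_measureReal_lt_dist`);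
  their laws are packaged as chord-supported probability measures
  (`exists_chordSupported_package`); the SLE_{8/3} law is chord-supported
  (`ae_isSimpleChord_map_sle`), so the welding marginals pass to the limit
  (`weldingMarginalsOfLimit`); two chordal SLE curves in one domain have the same law
  (`IsSLECurve.map_eq_holds`);
* `subseqIdentification_of_simpleSubseqLimits_of_latticeWeldingLaw`,
  `sawScalingLimit_of_simpleSubseqLimits_of_latticeWeldingLaw_of_eventualTight`: what remains of
  the route in lattice form (stmt-4982 ∧ lattice welding law [∧ stmt-1372]);
* `sawScalingLimit_iff_latticeWeldingLaw`: **modulo the three lattice-geometric inputs —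
  simplicity of subsequential limits (stmt-4982), eventual tightness (stmt-1372) and chord
  proxies — the conjunct `SAWScalingLimit` is EQUIVALENT to the lattice welding law.**

No new definition, no named fact; statements inlined as hypotheses.

References: Billingsley (1999) Thm 3.1; Sheffield, Ann. Probab. 44 (2016) §1.4; Lawler–Schramm–
Werner (2004) §3.4.2; Rohde–Schramm, Ann. Math. 161 (2005) Thm 6.1.
-/

noncomputable section

open MeasureTheory Filter Topology Set
open scoped NNReal BoundedContinuousFunction
open Literature.Probability.RandomPlanarGeometry Literature.Probability.LatticeModels
open Literature.Probability.Process (preWienerMeasure)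
open Summit.CriticalPhenomena.SAWScalingLimit.Theses

namespace Summit.CriticalPhenomena.SAWScalingLimit.Theorems.WeldingLawOfLimit

/-! ### The lattice form follows from the conjunct, given chord proxies -/

/-- **`SAWScalingLimit` ∧ chord proxies ⇒ `LatticeWeldingLaw`.** If the critical SAW converges in
law to chordal SLE_{8/3} in every Dobrushin domain (the conjunct `SAWScalingLimit`) and chord
proxies exist (hypothesis `hc`: functions `cₙ` of the walk at mesh `δₙ`, eventually almost surely
simple chords of `(Ω; a, b) = Q.chord 0 2`, close to the walk in probability — a purely geometric
input, no welding in it), then the canonical-welding marginals of the proxies converge to those of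
every chordal SLE_{8/3} random curve `Γ` in `(Ω; a, b)`: along `δₙ → 0⁺` the walks converge in law
to SLE (`tendsto_nhdsWithin_Ioi_of_pos`), hence so do the proxies (converging together), whose laws
are packaged as chord-supported probability measures (`exists_chordSupported_package`); the SLE law
is chord-supported (`ae_isSimpleChord_map_sle`), so the welding marginals pass to the limit
(`weldingMarginalsOfLimit`); two SLE curves in one domain have the same law
(`IsSLECurve.map_eq_holds`). Hence the lattice form is implied by the conjecture modulo chord
proxies — it adds no strength beyond that. [folklore] -/
theorem latticeWeldingLaw_of_sawScalingLimit (hS : _root_.SAWScalingLimit)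
    (hc : ∀ (Q : ConformalRectangle) (a b : ℝ → Site 2),
      SAW.IsEndpointApprox (Q.chord 0 2 (by decide)) a b →
      ∀ (δs : ℕ → ℝ), (∀ n, 0 < δs n) → Tendsto δs atTop (𝓝 0) →
      ∃ c : (n : ℕ) → SAW.DomainSAW Q.carrier (δs n) (a (δs n)) (b (δs n)) → CurveClass ℂ,
        (∀ᶠ n in atTop, ∀ᵐ ω ∂(SAW.law Q.carrier (δs n) (a (δs n)) (b (δs n))),
          (Q.chord 0 2 (by decide)).IsSimpleChord (c n ω)) ∧
        (∀ ε : ℝ, 0 < ε →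
          Tendsto (fun n => (SAW.law Q.carrier (δs n) (a (δs n)) (b (δs n))).real
            {ω | ε < dist ω.curve (c n ω)}) atTop (𝓝 0))) :
    (∀ (Q : ConformalRectangle) (a b : ℝ → Site 2),
      SAW.IsEndpointApprox (Q.chord 0 2 (by decide)) a b →
      ∀ (δs : ℕ → ℝ), (∀ n, 0 < δs n) → Tendsto δs atTop (𝓝 0) →
      ∃ c : (n : ℕ) → SAW.DomainSAW Q.carrier (δs n) (a (δs n)) (b (δs n)) → CurveClass ℂ,
        (∀ᶠ n in atTop, ∀ᵐ ω ∂(SAW.law Q.carrier (δs n) (a (δs n)) (b (δs n))),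
          (Q.chord 0 2 (by decide)).IsSimpleChord (c n ω)) ∧
        (∀ ε : ℝ, 0 < ε →
          Tendsto (fun n => (SAW.law Q.carrier (δs n) (a (δs n)) (b (δs n))).real
            {ω | ε < dist ω.curve (c n ω)}) atTop (𝓝 0)) ∧
        ∀ Γ : (NNReal → ℝ) → CurveClass ℂ,
          IsSLECurve ((8 : NNReal) / 3) (Q.chord 0 2 (by decide)) Γ →
          ∀ (k : ℕ) (x : Fin k → ℝ), (∀ i, 0 < x i) →
          ∀ g : BoundedContinuousFunction (Fin k → ℝ) ℝ,
            Tendsto (fun n => ∫ ω, g (fun i => conformalWelding Q (c n ω) (x i))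
                ∂(SAW.law Q.carrier (δs n) (a (δs n)) (b (δs n)))) atTop
              (𝓝 (∫ γ, g (fun i => conformalWelding Q γ (x i)) ∂(preWienerMeasure.map Γ)))) := by
  intro Q a b hab δs hpos hδ
  obtain ⟨c, hch, hd⟩ := hc Q a b hab δs hpos hδ
  refine ⟨c, hch, hd, fun Γ hΓ k x hx g => ?_⟩
  -- the conjunct along the sequence `δₙ → 0⁺`
  obtain ⟨Γ₀, hΓ₀, -, hT⟩ := hS (Q.chord 0 2 (by decide)) a b hab
  haveI : IsProbabilityMeasure preWienerMeasure :=
    Literature.Probability.RandomPlanarGeometry.isProbabilityMeasure_preWienerMeasure'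
  haveI : IsProbabilityMeasure (preWienerMeasure.map Γ₀) := Measure.isProbabilityMeasure_map hΓ₀.1
  have hseq : Tendsto δs atTop (𝓝[>] (0 : ℝ)) := tendsto_nhdsWithin_Ioi_of_pos hpos hδ
  have hlim : ∀ f : CurveClass ℂ →ᵇ ℝ,
      Tendsto (fun n => ∫ ω, f ω.curve ∂(SAW.law Q.carrier (δs n) (a (δs n)) (b (δs n)))) atTop
        (𝓝 (∫ γ, f γ ∂(preWienerMeasure.map Γ₀))) := by
    intro f
    rw [integral_map hΓ₀.1 f.continuous.aestronglyMeasurable]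
    exact (hT f).comp hseq
  -- the SAW laws along the sequence, eventually probability measures
  set μ : (n : ℕ) → Measure (SAW.DomainSAW Q.carrier (δs n) (a (δs n)) (b (δs n))) :=
    fun n => SAW.law Q.carrier (δs n) (a (δs n)) (b (δs n)) with hμdef
  have hμ : ∀ᶠ n in atTop, IsProbabilityMeasure (μ n) :=
    SubseqIdentification.Negative.eventually_isProbabilityMeasure_of_tendsto (hlim 1)
  -- the SLE law is chord-supported; package the proxies' laws
  have hν : ∀ᵐ γ ∂(preWienerMeasure.map Γ₀), (Q.chord 0 2 (by decide)).IsSimpleChord γ :=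
    ae_isSimpleChord_map_sle Q hΓ₀
  obtain ⟨Ps, hPsprob, hPsch, hPseq⟩ :=
    exists_chordSupported_package Q (preWienerMeasure.map Γ₀) hν μ hμ c hch
  have hmeas : ∀ n, AEMeasurable (c n) (μ n) := fun n =>
    (SAW.DomainSAW.measurable_of_top _).aemeasurable
  -- converging together: the proxies converge in law to SLE_{8/3} as well
  have hPslim : ∀ f : CurveClass ℂ →ᵇ ℝ,
      Tendsto (fun n => ∫ γ, f γ ∂(Ps n)) atTop (𝓝 (∫ γ, f γ ∂(preWienerMeasure.map Γ₀))) := by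
    intro f
    have key := tendsto_integral_comp_of_tendsto_measureReal_lt_dist (l := atTop) (μ := μ) hμ
      (X := fun n (ω : SAW.DomainSAW Q.carrier (δs n) (a (δs n)) (b (δs n))) => ω.curve) (Y := c)
      (Eventually.of_forall fun n => (SAW.DomainSAW.measurable_of_top _).aemeasurable)
      (Eventually.of_forall hmeas) (preWienerMeasure.map Γ₀) hlim hd f
    refine key.congr' ?_
    filter_upwards [hPseq] with n hn
    rw [hn, integral_map (hmeas n) f.continuous.aestronglyMeasurable]
  -- welding marginals pass to the chord-supported limit
  have hW := weldingMarginalsOfLimit Q Ps (preWienerMeasure.map Γ₀) hPsprob inferInstance hPsch hν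
    hPslim k x g
  -- the target SLE curve `Γ` has the same law as `Γ₀`
  rw [← IsSLECurve.map_eq_holds hΓ₀ hΓ]
  refine hW.congr' ?_
  filter_upwards [hPseq] with n hn
  have hgm : AEStronglyMeasurable
      (fun γ : CurveClass ℂ => g (fun i => conformalWelding Q γ (x i))) ((μ n).map (c n)) :=
    (g.continuous.measurable.comp (measurable_weldingVector Q x)).aestronglyMeasurable
  rw [hn, integral_map (hmeas n) hgm]

/-! ### What remains of the route, at item level, in lattice form -/

/-- **stmt-4982 ∧ `LatticeWeldingLaw` ⇒ stmt-0783** (`SubseqIdentification`, the shared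
identification crux of the sub-problem). [folklore] -/
theorem subseqIdentification_of_simpleSubseqLimits_of_latticeWeldingLaw
    (h1 : SAWLoopFugacityFlow.SimpleSubseqLimits)
    (hL : (∀ (Q : ConformalRectangle) (a b : ℝ → Site 2),
      SAW.IsEndpointApprox (Q.chord 0 2 (by decide)) a b →
      ∀ (δs : ℕ → ℝ), (∀ n, 0 < δs n) → Tendsto δs atTop (𝓝 0) →
      ∃ c : (n : ℕ) → SAW.DomainSAW Q.carrier (δs n) (a (δs n)) (b (δs n)) → CurveClass ℂ,
        (∀ᶠ n in atTop, ∀ᵐ ω ∂(SAW.law Q.carrier (δs n) (a (δs n)) (b (δs n))),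
          (Q.chord 0 2 (by decide)).IsSimpleChord (c n ω)) ∧
        (∀ ε : ℝ, 0 < ε →
          Tendsto (fun n => (SAW.law Q.carrier (δs n) (a (δs n)) (b (δs n))).real
            {ω | ε < dist ω.curve (c n ω)}) atTop (𝓝 0)) ∧
        ∀ Γ : (NNReal → ℝ) → CurveClass ℂ,
          IsSLECurve ((8 : NNReal) / 3) (Q.chord 0 2 (by decide)) Γ →
          ∀ (k : ℕ) (x : Fin k → ℝ), (∀ i, 0 < x i) →
          ∀ g : BoundedContinuousFunction (Fin k → ℝ) ℝ,
            Tendsto (fun n => ∫ ω, g (fun i => conformalWelding Q (c n ω) (x i))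
                ∂(SAW.law Q.carrier (δs n) (a (δs n)) (b (δs n)))) atTop
              (𝓝 (∫ γ, g (fun i => conformalWelding Q γ (x i)) ∂(preWienerMeasure.map Γ))))) :
    SAWLoopFugacityFlow.SubseqIdentification :=
  subseqIdentification_of_simpleSubseqLimits_of_approxWeldingLaw h1
    (approxWeldingLaw_of_latticeWeldingLaw hL)

/-- **stmt-4982 ∧ `LatticeWeldingLaw` ∧ stmt-1372 ⇒ `SAWScalingLimit`**: the conjunct from the
shared simplicity crux, the lattice welding law and eventual tightness. [folklore] -/
theorem sawScalingLimit_of_simpleSubseqLimits_of_latticeWeldingLaw_of_eventualTight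
    (h1 : SAWLoopFugacityFlow.SimpleSubseqLimits)
    (hL : (∀ (Q : ConformalRectangle) (a b : ℝ → Site 2),
      SAW.IsEndpointApprox (Q.chord 0 2 (by decide)) a b →
      ∀ (δs : ℕ → ℝ), (∀ n, 0 < δs n) → Tendsto δs atTop (𝓝 0) →
      ∃ c : (n : ℕ) → SAW.DomainSAW Q.carrier (δs n) (a (δs n)) (b (δs n)) → CurveClass ℂ,
        (∀ᶠ n in atTop, ∀ᵐ ω ∂(SAW.law Q.carrier (δs n) (a (δs n)) (b (δs n))),
          (Q.chord 0 2 (by decide)).IsSimpleChord (c n ω)) ∧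
        (∀ ε : ℝ, 0 < ε →
          Tendsto (fun n => (SAW.law Q.carrier (δs n) (a (δs n)) (b (δs n))).real
            {ω | ε < dist ω.curve (c n ω)}) atTop (𝓝 0)) ∧
        ∀ Γ : (NNReal → ℝ) → CurveClass ℂ,
          IsSLECurve ((8 : NNReal) / 3) (Q.chord 0 2 (by decide)) Γ →
          ∀ (k : ℕ) (x : Fin k → ℝ), (∀ i, 0 < x i) →
          ∀ g : BoundedContinuousFunction (Fin k → ℝ) ℝ,
            Tendsto (fun n => ∫ ω, g (fun i => conformalWelding Q (c n ω) (x i))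
                ∂(SAW.law Q.carrier (δs n) (a (δs n)) (b (δs n)))) atTop
              (𝓝 (∫ γ, g (fun i => conformalWelding Q γ (x i)) ∂(preWienerMeasure.map Γ)))))
    (hT : SAWWeldingIdentification.EventualTight) : _root_.SAWScalingLimit :=
  sawScalingLimit_of_simpleSubseqLimits_of_approxWeldingLaw_of_eventualTight h1
    (approxWeldingLaw_of_latticeWeldingLaw hL) hT

/-- **The sandwich.** Modulo the three lattice-geometric inputs — simplicity of subsequential
limits (stmt-4982 `SimpleSubseqLimits`), eventual tightness (stmt-1372 `EventualTight`) and the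
existence of chord proxies close to the walk in probability — the conjunct `SAWScalingLimit` is
EQUIVALENT to the lattice welding law (convergence of the canonical-welding marginals of the
proxies to SLE_{8/3}'s): `latticeWeldingLaw_of_sawScalingLimit` one way,
`sawScalingLimit_of_simpleSubseqLimits_of_latticeWeldingLaw_of_eventualTight` the other. This is
the precise sense in which "identify the ℤ² SAW limit by the law of its welding" loses nothing.
[folklore] -/
theorem sawScalingLimit_iff_latticeWeldingLaw :
    SAWLoopFugacityFlow.SimpleSubseqLimits → SAWWeldingIdentification.EventualTight →
    (∀ (Q : ConformalRectangle) (a b : ℝ → Site 2),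
      SAW.IsEndpointApprox (Q.chord 0 2 (by decide)) a b →
      ∀ (δs : ℕ → ℝ), (∀ n, 0 < δs n) → Tendsto δs atTop (𝓝 0) →
      ∃ c : (n : ℕ) → SAW.DomainSAW Q.carrier (δs n) (a (δs n)) (b (δs n)) → CurveClass ℂ,
        (∀ᶠ n in atTop, ∀ᵐ ω ∂(SAW.law Q.carrier (δs n) (a (δs n)) (b (δs n))),
          (Q.chord 0 2 (by decide)).IsSimpleChord (c n ω)) ∧
        (∀ ε : ℝ, 0 < ε →
          Tendsto (fun n => (SAW.law Q.carrier (δs n) (a (δs n)) (b (δs n))).real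
            {ω | ε < dist ω.curve (c n ω)}) atTop (𝓝 0))) →
    (_root_.SAWScalingLimit ↔
    (∀ (Q : ConformalRectangle) (a b : ℝ → Site 2),
      SAW.IsEndpointApprox (Q.chord 0 2 (by decide)) a b →
      ∀ (δs : ℕ → ℝ), (∀ n, 0 < δs n) → Tendsto δs atTop (𝓝 0) →
      ∃ c : (n : ℕ) → SAW.DomainSAW Q.carrier (δs n) (a (δs n)) (b (δs n)) → CurveClass ℂ,
        (∀ᶠ n in atTop, ∀ᵐ ω ∂(SAW.law Q.carrier (δs n) (a (δs n)) (b (δs n))),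
          (Q.chord 0 2 (by decide)).IsSimpleChord (c n ω)) ∧
        (∀ ε : ℝ, 0 < ε →
          Tendsto (fun n => (SAW.law Q.carrier (δs n) (a (δs n)) (b (δs n))).real
            {ω | ε < dist ω.curve (c n ω)}) atTop (𝓝 0)) ∧
        ∀ Γ : (NNReal → ℝ) → CurveClass ℂ,
          IsSLECurve ((8 : NNReal) / 3) (Q.chord 0 2 (by decide)) Γ →
          ∀ (k : ℕ) (x : Fin k → ℝ), (∀ i, 0 < x i) →
          ∀ g : BoundedContinuousFunction (Fin k → ℝ) ℝ,
            Tendsto (fun n => ∫ ω, g (fun i => conformalWelding Q (c n ω) (x i))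
                ∂(SAW.law Q.carrier (δs n) (a (δs n)) (b (δs n)))) atTop
              (𝓝 (∫ γ, g (fun i => conformalWelding Q γ (x i)) ∂(preWienerMeasure.map Γ))))) :=
  fun h1 hT hc =>
    ⟨fun hS => latticeWeldingLaw_of_sawScalingLimit hS hc,
      fun hL => sawScalingLimit_of_simpleSubseqLimits_of_latticeWeldingLaw_of_eventualTight h1 hL hT⟩

end Summit.CriticalPhenomena.SAWScalingLimit.Theorems.WeldingLawOfLimit

end
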